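import Summits.BirchSwinnertonDyer.BirchSwinnertonDyer.Theorems.ManinLocalTwoThreeShimuraKernelCyclicOfThreeFacts
import Literature.NumberTheory.EllipticCurves.EichlerShimuraConstructionCongruenceProofs
import Literature.NumberTheory.EllipticCurves.ModularCurveManinSemistableBridgeProofs
import HarnessLib

/-!
# The `f`-only rows 2♮/1♮: `Λ₀(f)/Λ₁(f)` is cyclic for EVERY rational newform, modulo {Eichler–Shimura construction, modularity, CES, T-es-75}
(route `ManinLocalTwoThree`, crux C2 `ManinOddAtFour` stmt-BirchSwinnertonDyer-22967; cell bsd-f2-manin, prover seat p2 gen 23;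
`--supports stmt-BirchSwinnertonDyer-22967`; desc g26 `ShimuraKernelCyclic.lean` §5 rows `NewformShimuraKernelCyclic` (E-desc-g26-2♮) and
`NewformGamma1PeriodsNotInsideTwice` (E-desc-g26-1♮, the A-ref1-215-1 shape), sequel of p3's `KummerValues.shimuraKernelCyclic_of_modularity_CES_Tes75`)

The carrier rows (`ShimuraKernelCyclic`, `Gamma1PeriodsNotInsideTwiceGamma0Periods`) quantify over modular parametrisation DATA and are kernel
theorems modulo {modularity, CES, T-es-75} (p3 gen 20 `…ShimuraKernelCyclicOfThreeFacts`, over p2's E-es-190 + assembly, p3's 188/189 and es's EXO).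
The `f`-only rows quantify over bare rational newforms `f ∈ S₂(Γ₀(N))` (`IsNewform0 f`, `coeffField f = ⊥`) and need a CARRIER: an elliptic
`W₀/ℚ` with `IsNewformOf W₀ f` and a datum with newform `f`.  The tree's named fact `eichlerShimuraConstruction` (Knapp Thm. 11.74 / 12.8,
statement-only) supplies `W₀` with Néron lattice exactly `Λ_f` (`latticeEq_of_eichlerShimuraConstruction`); the datum is then built as in
`ModularParametrizationData.exists_optimalDatum'` (uniformisation `IsNeronLatticeOf.exists_uniformize_holds`, degree `exists_modularDegree_holds`).

* `exists_datum_of_latticeEq` — datum constructor: an elliptic `W₀` with `IsNewformOf W₀ f` and a Néron-type period pair spanning `Λ_f`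
  carries a datum `D₀` at level `N` with `D₀.f = f`, `D₀.c = 1` (fact-free; the `exists_optimalDatum'` construction with `f` given);
* `exists_datum_of_eichlerShimuraConstruction` — every rational newform is the newform of a datum (⟸ `eichlerShimuraConstruction`);
* **`newformShimuraKernelCyclic_of_ES_modularity_CES_Tes75`** — row 2♮ BY NAME; **`newformGamma1PeriodsNotInsideTwice_of_ES_modularity_CES_Tes75`** —
  row 1♮ BY NAME (desc's glue `newformNotInsideTwice_of_newformCyclic`); `newform_not_prime_le_of_ES_modularity_CES_Tes75` — every prime.

HONEST FRAMING: CONDITIONAL on four statement-only printed facts (Eichler–Shimura construction, modularity, CES, T-es-75).  Nothing about C2,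
Manin's conjecture or BSD is proved.  No definitions, no sorry.
[cite: Knapp1993, Thm. 11.74 (c)(d)(e), Thm. 12.8] [cite: Vatsal2005, Rem. 1.8, Conj. 1.9] [cite: Stevens1982, §1.3 Thm. 1.3.1 (b)]
-/

set_option autoImplicit false
-- lint-debt: the directory name repeats the summit name (sibling precedent `ManinLocalTwoThreeShimuraKernelCyclicOfThreeFacts.lean`)
set_option linter.dupNamespace false

noncomputable section

open scoped MatrixGroups ModularForm
open CongruenceSubgroup UpperHalfPlane WeierstrassCurve Literature.NumberTheory.EllipticCurves Literature.NumberTheory.EllipticCurves.ModularForms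
open Summit.BirchSwinnertonDyer.Rank1Residual.ManinAdditive

namespace Summit.BirchSwinnertonDyer.BirchSwinnertonDyer.Theorems.ManinLocalTwoThree.ShimuraKernelCyclicOfFacts

/-! ## §1 The carrier: a datum for a bare rational newform -/

/-- **Datum constructor.**  An elliptic `W₀/ℚ` whose newform is `f` and which has a Néron-type period pair `L₀` spanning exactly `Λ_f` carries a
modular parametrisation datum `D₀` at level `N` with `D₀.f = f`, `D₀.L = L₀` and Manin constant `1` (so it is lattice-optimal).  Verbatim the construction
of `ModularParametrizationData.exists_optimalDatum'` (uniformisation by `IsNeronLatticeOf.exists_uniformize_holds`, degree by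
`exists_modularDegree_holds`, exceptional set transported along `ℂ/Λ_f ≃ W₀(ℂ)`).  Fact-free. [cite: Knapp1993, Thm. 11.74 (c)(d)] -/
theorem exists_datum_of_latticeEq {N : ℕ} [NeZero N] {f : CuspForm (Gamma0 N) 2} (W₀ : WeierstrassCurve ℚ) [W₀.IsElliptic]
    (hf₀ : IsNewformOf W₀ f) {L₀ : PeriodPair} (hL₀ : IsNeronLatticeOf (W₀.baseChange ℂ) L₀) (hΛ : (L₀.lattice : Set ℂ) = periodLattice f) :
    ∃ D₀ : ModularParametrizationData W₀ N, D₀.f = f ∧ D₀.L = L₀ ∧ D₀.c = 1 := by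
  -- adapted from `ModularParametrizationData.exists_optimalDatum'` (Literature `ModularCurveManinSemistableBridgeProofs`)
  haveI : (W₀.baseChange ℂ).IsElliptic := by rw [WeierstrassCurve.baseChange]; infer_instance
  obtain ⟨u, hker, hsurj, hspec⟩ := IsNeronLatticeOf.exists_uniformize_holds hL₀
  have hmem : ∀ z : ℂ, z ∈ L₀.lattice ↔ z ∈ periodLattice f := fun z ↦ by
    rw [← SetLike.mem_coe, hΛ, SetLike.mem_coe]
  have hc : ∀ z ∈ periodLattice f, ((1 : ℤ) : ℂ) * z ∈ L₀.lattice := fun z hz ↦ by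
    rw [Int.cast_one, one_mul, hmem]
    exact hz
  obtain ⟨d, hd, hfin⟩ := exists_modularDegree_holds hf₀.1.ne_zero
    (L := L₀) (c := ((1 : ℤ) : ℂ)) (Int.cast_ne_zero.mpr one_ne_zero) hc
  have hker' : L₀.lattice.toAddSubgroup = u.ker :=
    SetLike.coe_injective (by rw [Submodule.coe_toAddSubgroup, hker])
  let e : ℂ ⧸ L₀.lattice.toAddSubgroup ≃+ (W₀.baseChange ℂ).toAffine.Point :=
    QuotientAddGroup.liftEquiv L₀.lattice.toAddSubgroup hsurj hker'
  have he : ∀ x : ℂ, e.toEquiv (x : ℂ ⧸ L₀.lattice.toAddSubgroup) = u x := fun _ ↦ rfl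
  have key := (finite_setOf_card_fiberOrbits_ne_iff e.toEquiv
    (fun τ : ℍ ↦ ((((1 : ℤ) : ℂ) * eichlerIntegral f τ : ℂ) : ℂ ⧸ L₀.lattice.toAddSubgroup)) d).mpr hfin
  simp only [he] at key
  refine ⟨
    { f := f
      isNewformOf := hf₀
      L := L₀
      isNeronLattice := hL₀
      uniformize := u
      ker_uniformize := hker
      uniformize_surjective := hsurj
      uniformize_spec := hspec
      c := 1
      smul_periodLattice_le := hc
      deg := d
      deg_pos := hd
      deg_spec := key }, rfl, rfl, rfl⟩

/-- **Every rational newform is the newform of a modular parametrisation datum of an elliptic curve over `ℚ`, modulo the Eichler–Shimura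
construction fact** (`latticeEq_of_eichlerShimuraConstruction`: the `ℚ`-model of `ℂ/Λ_f` with `aₙ = aₙ(f)`; integer coefficients by
`IsNewform0.exists_intCast_eq_cuspCoeff`).  CONDITIONAL on `eichlerShimuraConstruction`. [cite: Knapp1993, Thm. 11.74 (d)(e), Thm. 12.8] -/
theorem exists_datum_of_eichlerShimuraConstruction (hES : eichlerShimuraConstruction) {N : ℕ} [NeZero N] (f : CuspForm (Gamma0 N) 2)
    (hf : IsNewform0 f) (hQ : coeffField f = ⊥) :
    ∃ (W₀ : WeierstrassCurve ℚ) (_ : W₀.IsElliptic) (D₀ : ModularParametrizationData W₀ N), D₀.f = f := by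
  obtain ⟨W₀, hW₀, hf₀, L₀, hL₀, hΛ⟩ := latticeEq_of_eichlerShimuraConstruction hES hf (hf.exists_intCast_eq_cuspCoeff hQ)
  haveI := hW₀
  obtain ⟨D₀, hD₀, -, -⟩ := exists_datum_of_latticeEq W₀ hf₀ hL₀ hΛ
  exact ⟨W₀, hW₀, D₀, hD₀⟩

/-! ## §2 The `f`-only rows BY NAME -/

/-- **desc g26 row 2♮ `ShimuraCyclic.NewformShimuraKernelCyclic` BY NAME modulo {Eichler–Shimura construction, modularity, CES, T-es-75}**: for every
rational newform `f ∈ S₂(Γ₀(N))`, `Λ₀(f) = ℤz₀ + Λ₁(f)` — the carrier row `ShimuraKernelCyclic` (p3's `KummerValues.shimuraKernelCyclic_of_modularity_CES_Tes75`)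
at the datum of §1.  CONDITIONAL. [cite: Vatsal2005, Rem. 1.8, Conj. 1.9] [cite: Knapp1993, Thm. 11.74] -/
theorem newformShimuraKernelCyclic_of_ES_modularity_CES_Tes75 (hES : eichlerShimuraConstruction) (hnf : exists_isNewformOf)
    (hCES : exists_optimal_gamma1ParametrizationData) (hSt : optimalGamma1Parametrization_cuspInv_galoisAction) :
    ShimuraCyclic.NewformShimuraKernelCyclic := by
  intro N _ f hf hQ
  obtain ⟨W₀, _, D₀, hD₀⟩ := exists_datum_of_eichlerShimuraConstruction hES f hf hQ
  rw [← hD₀]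
  exact KummerValues.shimuraKernelCyclic_of_modularity_CES_Tes75 hnf hCES hSt W₀ D₀

/-- **desc g26 row 1♮ `ShimuraCyclic.NewformGamma1PeriodsNotInsideTwice` BY NAME** (the A-ref1-215-1 shape `Λ₁(f) ⊄ 2Λ₀(f)` for every rational
newform) modulo the same four facts (desc's glue `newformNotInsideTwice_of_newformCyclic`).  CONDITIONAL. [cite: Stevens1989, §2] -/
theorem newformGamma1PeriodsNotInsideTwice_of_ES_modularity_CES_Tes75 (hES : eichlerShimuraConstruction) (hnf : exists_isNewformOf)
    (hCES : exists_optimal_gamma1ParametrizationData) (hSt : optimalGamma1Parametrization_cuspInv_galoisAction) :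
    ShimuraCyclic.NewformGamma1PeriodsNotInsideTwice :=
  ShimuraCyclic.newformNotInsideTwice_of_newformCyclic (newformShimuraKernelCyclic_of_ES_modularity_CES_Tes75 hES hnf hCES hSt)

/-- **Every prime, every rational newform**: `Λ₁(f) ⊄ ℓΛ₀(f)` modulo the same four facts (row 2♮ + the parity lemma
`ShimuraKernelLattice.not_prime_le_of_cyclic`).  CONDITIONAL. [cite: Vatsal2005, Rem. 1.4] -/
theorem newform_not_prime_le_of_ES_modularity_CES_Tes75 (hES : eichlerShimuraConstruction) (hnf : exists_isNewformOf)
    (hCES : exists_optimal_gamma1ParametrizationData) (hSt : optimalGamma1Parametrization_cuspInv_galoisAction)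
    {N : ℕ} [NeZero N] (f : CuspForm (Gamma0 N) 2) (hf : IsNewform0 f) (hQ : coeffField f = ⊥) {ℓ : ℕ} (hℓ : ℓ.Prime) :
    ¬ (∀ z ∈ periodLatticeGamma1 f, ∃ w ∈ periodLattice f, z = (ℓ : ℂ) * w) := by
  obtain ⟨z₀, hz₀, hcyc⟩ := newformShimuraKernelCyclic_of_ES_modularity_CES_Tes75 hES hnf hCES hSt f hf hQ
  exact ShimuraKernelLattice.not_prime_le_of_cyclic f hf hQ hz₀ hcyc hℓ

/-- The `f`-only literal A-ref1-215-1 shape `¬(Λ₁(f) = 2Λ₀(f))` for every rational newform, modulo the four facts (desc's glue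
`newform_periodLatticeGamma1_ne_two_mul`).  CONDITIONAL. [cite: Stevens1989, §2] -/
theorem newform_periodLatticeGamma1_ne_two_mul_of_ES_modularity_CES_Tes75 (hES : eichlerShimuraConstruction) (hnf : exists_isNewformOf)
    (hCES : exists_optimal_gamma1ParametrizationData) (hSt : optimalGamma1Parametrization_cuspInv_galoisAction)
    {N : ℕ} [NeZero N] (f : CuspForm (Gamma0 N) 2) (hf : IsNewform0 f) (hQ : coeffField f = ⊥) :
    ¬ (∀ z : ℂ, z ∈ periodLatticeGamma1 f ↔ ∃ w ∈ periodLattice f, z = 2 * w) :=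
  ShimuraCyclic.newform_periodLatticeGamma1_ne_two_mul (newformGamma1PeriodsNotInsideTwice_of_ES_modularity_CES_Tes75 hES hnf hCES hSt) f hf hQ

end Summit.BirchSwinnertonDyer.BirchSwinnertonDyer.Theorems.ManinLocalTwoThree.ShimuraKernelCyclicOfFacts

end
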